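import Mathlib
import Summits.MatrixMultiplication.Statement

/-!
# Graph equations — jet algebra for the specialisation of the identity tower (M24a)

Pure commutative algebra used to pass from the identity tower at the generic point `K = ℂ(a,b)`
(`exists_towerStages`) to the `ℂ`-point data of the S1 binder (NODE-g36 §3, files E2/E3):

* `jetIdeal σ A k` — the ideal of polynomials all of whose coefficients of degree `≤ k` vanish
  (`= 𝔪₀^{k+1}` for finitely many variables); products raise the order (`mul_mem_jetIdeal`), a
  polynomial with zero constant coefficient lies in `jetIdeal 0`;
* `invJet` — the explicit inverse 2-jet `δ⁻¹ - δ⁻² e + δ⁻³ e²` of `C δ + e`, `constantCoeff e = 0`: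
  `(C δ + e) * invJet - 1 ∈ jetIdeal 2` (`mul_invJet_sub_one_mem`);
* `clearEval F N d M` — the `d^M`-cleared evaluation of `F` at `N/d` (a polynomial in the
  coefficients), with `map_clearEval`: under any ring hom `φ` with `φ d * dinv = 1`,
  `φ (clearEval F N d M) = φ d ^ M * eval₂ φ (φ N · dinv) F`; hence a cleared identity
  `clearEval = 0` transports the vanishing of `F(N/d)` from the fraction field to every ring in
  which `d` becomes invertible — a `ℂ`-point (`φ = eval p`, `d p ≠ 0`) or the 2-jet ring
  (`φ = mk ∘ shift`, `eval₂_mem_jetIdeal_of_clearEval_eq_zero`).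
-/

set_option linter.dupNamespace false

noncomputable section

open scoped BigOperators

namespace Summit.MatrixMultiplication.MatrixMultiplication.Theorems.GraphEquations

open MvPolynomial

section JetIdeal

variable {σ : Type*} {A : Type*} [CommRing A]

/-- The ideal of polynomials whose coefficients of degree `≤ k` all vanish. -/
def jetIdeal (σ : Type*) (A : Type*) [CommRing A] (k : ℕ) : Ideal (MvPolynomial σ A) where
  carrier := {f | ∀ m : σ →₀ ℕ, m.degree ≤ k → coeff m f = 0}
  add_mem' hf hg m hm := by rw [coeff_add, hf m hm, hg m hm, add_zero]
  zero_mem' m _ := coeff_zero m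
  smul_mem' c f hf m hm := by
    classical
    rw [smul_eq_mul, coeff_mul]
    refine Finset.sum_eq_zero fun ij hij => ?_
    rw [Finset.HasAntidiagonal.mem_antidiagonal] at hij
    have hdeg : ij.2.degree ≤ k := by
      have h := congrArg Finsupp.degree hij
      rw [map_add] at h
      omega
    rw [hf _ hdeg, mul_zero]

/-- Membership in `jetIdeal`. -/
theorem mem_jetIdeal {k : ℕ} {f : MvPolynomial σ A} :
    f ∈ jetIdeal σ A k ↔ ∀ m : σ →₀ ℕ, m.degree ≤ k → coeff m f = 0 := Iff.rfl

/-- `jetIdeal` is antitone in the order. -/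
theorem jetIdeal_mono {k k' : ℕ} (h : k ≤ k') : jetIdeal σ A k' ≤ jetIdeal σ A k :=
  fun _ hf m hm => hf m (hm.trans h)

/-- Products raise the order: `jetIdeal k₁ * jetIdeal k₂ ⊆ jetIdeal (k₁ + k₂ + 1)`. -/
theorem mul_mem_jetIdeal {k₁ k₂ : ℕ} {f g : MvPolynomial σ A} (hf : f ∈ jetIdeal σ A k₁)
    (hg : g ∈ jetIdeal σ A k₂) : f * g ∈ jetIdeal σ A (k₁ + k₂ + 1) := by
  classical
  intro m hm
  rw [coeff_mul]
  refine Finset.sum_eq_zero fun ij hij => ?_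
  rw [Finset.HasAntidiagonal.mem_antidiagonal] at hij
  have h := congrArg Finsupp.degree hij
  rw [map_add] at h
  by_cases h1 : ij.1.degree ≤ k₁
  · rw [hf _ h1, zero_mul]
  · have h2 : ij.2.degree ≤ k₂ := by omega
    rw [hg _ h2, mul_zero]

/-- A polynomial with zero constant coefficient vanishes to order `1`. -/
theorem mem_jetIdeal_zero_of_constantCoeff {e : MvPolynomial σ A} (he : constantCoeff e = 0) :
    e ∈ jetIdeal σ A 0 := by
  intro m hm
  have : m = 0 := (Finsupp.degree_eq_zero_iff m).mp (Nat.le_zero.mp hm)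
  subst this
  exact he

/-- The cube of a polynomial with zero constant coefficient vanishes to order `3`. -/
theorem pow_three_mem_jetIdeal_two {e : MvPolynomial σ A} (he : constantCoeff e = 0) :
    e ^ 3 ∈ jetIdeal σ A 2 := by
  have h0 := mem_jetIdeal_zero_of_constantCoeff he
  have h1 : e * e ∈ jetIdeal σ A 1 := mul_mem_jetIdeal h0 h0
  have h2 : e * e * e ∈ jetIdeal σ A 2 := mul_mem_jetIdeal h1 h0
  rw [pow_succ, pow_two]; exact h2

/-- In the quotient by `jetIdeal 2` the class of a polynomial with invertible constant coefficient
times the class of its inverse jet is `1`: explicit inverse 2-jet. -/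
def invJet {F : Type*} [Field F] (δ : F) (e : MvPolynomial σ F) : MvPolynomial σ F :=
  C δ⁻¹ - C δ⁻¹ ^ 2 * e + C δ⁻¹ ^ 3 * e ^ 2

/-- `(C δ + e) · invJet δ e - 1 = δ⁻³ e³`. -/
theorem mul_invJet_sub_one {F : Type*} [Field F] {δ : F} (hδ : δ ≠ 0) (e : MvPolynomial σ F) :
    (C δ + e) * invJet δ e - 1 = C δ⁻¹ ^ 3 * e ^ 3 := by
  have h1 : (C δ : MvPolynomial σ F) * C δ⁻¹ = 1 := by rw [← C_mul, mul_inv_cancel₀ hδ, C_1]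
  unfold invJet
  linear_combination (1 - C δ⁻¹ * e + C δ⁻¹ ^ 2 * e ^ 2) * h1

/-- The inverse jet inverts modulo `jetIdeal 2`. -/
theorem mul_invJet_sub_one_mem {F : Type*} [Field F] {δ : F} (hδ : δ ≠ 0) {e : MvPolynomial σ F}
    (he : constantCoeff e = 0) : (C δ + e) * invJet δ e - 1 ∈ jetIdeal σ F 2 := by
  rw [mul_invJet_sub_one hδ]
  exact Ideal.mul_mem_left _ _ (pow_three_mem_jetIdeal_two he)

/-- Decomposition of a polynomial into its constant coefficient and a constant-free part. -/
theorem eq_C_constantCoeff_add (d : MvPolynomial σ A) :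
    d = C (constantCoeff d) + (d - C (constantCoeff d)) ∧
      constantCoeff (d - C (constantCoeff d)) = 0 := by
  refine ⟨by ring, ?_⟩
  rw [map_sub, constantCoeff_C, sub_self]

/-- A polynomial with non-zero constant coefficient is a unit modulo `jetIdeal 2`. -/
theorem exists_mul_sub_one_mem_jetIdeal {F : Type*} [Field F] {d : MvPolynomial σ F}
    (hd : constantCoeff d ≠ 0) : ∃ ι : MvPolynomial σ F, d * ι - 1 ∈ jetIdeal σ F 2 := by
  obtain ⟨hdec, he⟩ := eq_C_constantCoeff_add d
  refine ⟨invJet (constantCoeff d) (d - C (constantCoeff d)), ?_⟩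
  have h := mul_invJet_sub_one_mem hd he
  rwa [← hdec] at h

end JetIdeal

section Clear

variable {κ : Type*} {A B : Type*} [CommRing A] [CommRing B]

/-- The `d^M`-cleared evaluation of `F` at `N / d`:  `∑_mono coeff · N^mono · d^(M - |mono|)`. -/
def clearEval (F : MvPolynomial κ A) (N : κ → A) (d : A) (M : ℕ) : A :=
  ∑ mono ∈ F.support, coeff mono F * (∏ x ∈ mono.support, N x ^ mono x) * d ^ (M - mono.degree)

/-- **Transport of cleared identities.**  Under a ring hom `φ` for which `φ d` has the inverse
`dinv`, the cleared evaluation is `φ d ^ M` times the evaluation at `φ N · dinv`. -/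
theorem map_clearEval (φ : A →+* B) (F : MvPolynomial κ A) (N : κ → A) (d : A) {M : ℕ}
    (hM : ∀ mono ∈ F.support, mono.degree ≤ M) (dinv : B) (hd : φ d * dinv = 1) :
    φ (clearEval F N d M) = φ d ^ M * eval₂ φ (fun x => φ (N x) * dinv) F := by
  rw [clearEval, eval₂_eq, map_sum, Finset.mul_sum]
  refine Finset.sum_congr rfl fun mono hmono => ?_
  rw [map_mul, map_mul, map_prod, map_pow]
  simp_rw [map_pow, mul_pow]
  rw [Finset.prod_mul_distrib, Finset.prod_pow_eq_pow_sum]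
  have hdeg : ∑ i ∈ mono.support, mono i = mono.degree := rfl
  rw [hdeg]
  have hsplit : φ d ^ M = φ d ^ (M - mono.degree) * φ d ^ mono.degree := by
    rw [← pow_add, Nat.sub_add_cancel (hM mono hmono)]
  have hone : φ d ^ mono.degree * dinv ^ mono.degree = 1 := by rw [← mul_pow, hd, one_pow]
  calc φ (coeff mono F) * (∏ x ∈ mono.support, φ (N x) ^ mono x) * φ d ^ (M - mono.degree)
      = φ d ^ (M - mono.degree) * (φ d ^ mono.degree * dinv ^ mono.degree) *
          (φ (coeff mono F) * ∏ x ∈ mono.support, φ (N x) ^ mono x) := by rw [hone]; ring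
    _ = φ d ^ M * (φ (coeff mono F) *
          ((∏ x ∈ mono.support, φ (N x) ^ mono x) * dinv ^ mono.degree)) := by rw [hsplit]; ring

/-- The support bound with `M = ∑` of degrees (any bound works; this one is canonical). -/
theorem degree_le_sum_support (F : MvPolynomial κ A) :
    ∀ mono ∈ F.support, mono.degree ≤ ∑ m ∈ F.support, m.degree := fun _ hmono =>
  Finset.single_le_sum (fun _ _ => Nat.zero_le _) hmono

/-- **Cleared identity at a point where `d` is invertible.**  If `clearEval F N d M = 0` and
`φ d * dinv = 1` with `φ d` a non-zero-divisor… — here in the form used: `B` a domain/any ring in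
which `φ d` is a unit: the evaluation at `φ N · dinv` vanishes. -/
theorem eval₂_eq_zero_of_clearEval_eq_zero (φ : A →+* B) {F : MvPolynomial κ A} {N : κ → A}
    {d : A} {M : ℕ} (hM : ∀ mono ∈ F.support, mono.degree ≤ M) {dinv : B} (hd : φ d * dinv = 1)
    (h0 : clearEval F N d M = 0) : eval₂ φ (fun x => φ (N x) * dinv) F = 0 := by
  have h := map_clearEval φ F N d hM dinv hd
  rw [h0, map_zero] at h
  have hu : IsUnit (φ d ^ M) := (isUnit_iff_exists_inv.mpr ⟨dinv, hd⟩).pow M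
  exact (hu.mul_right_eq_zero).mp h.symm

/-- **Cleared identity from the fraction field.**  If `F(N/d) = 0` in a field of fractions `K` of
`A`, then `clearEval F N d M = 0` in `A`. -/
theorem clearEval_eq_zero_of_eval₂_eq_zero {K : Type*} [Field K] [Algebra A K] [IsFractionRing A K]
    {F : MvPolynomial κ A} {N : κ → A} {d : A} (hd : algebraMap A K d ≠ 0) {M : ℕ}
    (hM : ∀ mono ∈ F.support, mono.degree ≤ M)
    (h0 : eval₂ (algebraMap A K) (fun x => algebraMap A K (N x) * (algebraMap A K d)⁻¹) F = 0) :
    clearEval F N d M = 0 := by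
  apply IsFractionRing.injective A K
  rw [map_clearEval (algebraMap A K) F N d hM _ (mul_inv_cancel₀ hd), h0, mul_zero, map_zero]

/-- **Into the 2-jet ring.**  If `clearEval F N d M = 0` and, after a ring hom `sh : A → MvPolynomial
σ F'` (the shift to the chosen point), `sh d` has non-zero constant coefficient, then
`F` evaluated at `sh N · ι` lies in `jetIdeal 2`, `ι` the inverse jet of `sh d`. -/
theorem eval₂_mem_jetIdeal_of_clearEval_eq_zero {σ : Type*} {F' : Type*} [Field F']
    (sh : A →+* MvPolynomial σ F') {F : MvPolynomial κ A} {N : κ → A} {d : A} {M : ℕ}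
    (hM : ∀ mono ∈ F.support, mono.degree ≤ M) (h0 : clearEval F N d M = 0)
    {ι : MvPolynomial σ F'} (hι : sh d * ι - 1 ∈ jetIdeal σ F' 2) :
    eval₂ sh (fun x => sh (N x) * ι) F ∈ jetIdeal σ F' 2 := by
  rw [← Ideal.Quotient.eq_zero_iff_mem]
  have hd : (Ideal.Quotient.mk (jetIdeal σ F' 2)).comp sh d * Ideal.Quotient.mk _ ι = 1 := by
    rw [RingHom.comp_apply, ← map_mul, ← (Ideal.Quotient.mk _).map_one, Ideal.Quotient.eq]
    exact hι
  have h := eval₂_eq_zero_of_clearEval_eq_zero ((Ideal.Quotient.mk (jetIdeal σ F' 2)).comp sh)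
    hM hd h0
  rw [eval₂_comp_left]
  have hfun : (⇑(Ideal.Quotient.mk (jetIdeal σ F' 2)) ∘ fun x => sh (N x) * ι) = fun x =>
      ((Ideal.Quotient.mk (jetIdeal σ F' 2)).comp sh) (N x) * Ideal.Quotient.mk _ ι := by
    funext x; simp only [Function.comp_apply, map_mul, RingHom.comp_apply]
  rw [hfun]; exact h

end Clear

section Vanishing

variable {σ : Type*} {F' : Type*} [Field F']

/-- Degree-two coefficients of a member of `jetIdeal 2` vanish (the form used for `hsec`). -/
theorem coeff_eq_zero_of_mem_jetIdeal_two {f : MvPolynomial σ F'} (hf : f ∈ jetIdeal σ F' 2)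
    (u v : σ) : coeff (Finsupp.single u 1 + Finsupp.single v 1) f = 0 :=
  hf _ (by rw [map_add, Finsupp.degree_single, Finsupp.degree_single])

/-- Constant and linear coefficients of a member of `jetIdeal 2` vanish as well. -/
theorem coeff_single_eq_zero_of_mem_jetIdeal_two {f : MvPolynomial σ F'}
    (hf : f ∈ jetIdeal σ F' 2) (u : σ) : coeff (Finsupp.single u 1) f = 0 :=
  hf _ (by rw [Finsupp.degree_single]; norm_num)

end Vanishing

end Summit.MatrixMultiplication.MatrixMultiplication.Theorems.GraphEquations

end
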